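import Summits.AtomisticToContinuum.HydrodynamicLimit.Theorems.CollisionIsometryCLTAdaptedWeightCLTTimeLocal

/-!
# Column depolarisation, part E: admissibility of the line window, H1 on the line window, and the
# collision-rate input
(helpers for the registered stub `stub_columnDepolarisation` of the line `contact-source-duhamel`,
crux `CollisionIsometryCLT.AdaptedWeightCLT`, stmt-AtomisticToContinuum-14868; `--supports`,
anchor `lineWindow_pos`)

* The LINE WINDOW `Δℓ_N = (N+1)^{-1/3} log(N+2)` is admissible: `lineWindow_pos`, `lineWindow_mul_rpow`
  (`Δℓ_N (N+1)^{1/3} = log(N+2)`), `tendsto_lineWindow_mul_rpow_atTop`, `tendsto_lineWindow_nhds_zero`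
  (`log(N+2) ≤ log 2 + log(N+1)` and `log x = o(x^{1/3})`); hence H1 applies to it:
  `diffuseAt_lineWindow` — the local-Gibbs mean of `iprF` over `[t − Δℓ_N, t]` tends to `0`.
* `ManyCollisionsAt σ a₀ θ₀ u₀ Φ` (typed, asserted nowhere): for every `K`, the probability that the
  fold restarted at `Φ_{t−Δℓ_N} z` performs fewer than `K(N+1)` steps during the second half
  `[Δℓ_N/2, Δℓ_N]` of the line window tends to `0` — the collision-RATE input of the depolarisation
  mechanism (physically `≍ σ² log N → ∞` collisions per particle per half-window). It is NOT a
  consequence of H1: a row is fully delocalised after three of its own reflections with pairwise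
  orthogonal normals (`Q₃Q₂Q₁ = 0`), so `iprF → 0` forces only `≳ 3/2` collisions per particle
  (rows with at most two own reflections keep `‖M_ii‖_F² ≥ 1`).
-/

namespace Summit.AtomisticToContinuum.HydrodynamicLimit.Theorems.ContactSourceDuhamel.TimeLocal
namespace ColumnDepolarisation

open scoped BigOperators Topology Classical MeasureTheory ENNReal InnerProductSpace
open Filter Set MeasureTheory
open Literature.Analysis.FluidPDE
open Literature.MathematicalPhysics.KineticTheory (hsDiameter localGibbsLaw)

noncomputable section

/-! ## The line window is admissible -/

/-- `0 < Δℓ_N`. -/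
theorem lineWindow_pos : ∀ N : ℕ, 0 < Δℓ N := by
  intro N
  unfold Δℓ
  refine mul_pos (Real.rpow_pos_of_pos (by positivity) _) (Real.log_pos ?_)
  have : (0 : ℝ) ≤ N := Nat.cast_nonneg N
  linarith

/-- `Δℓ_N (N+1)^{1/3} = log(N+2)`. -/
theorem lineWindow_mul_rpow (N : ℕ) :
    Δℓ N * ((N + 1 : ℕ) : ℝ) ^ ((1 : ℝ) / 3) = Real.log ((N : ℝ) + 2) := by
  unfold Δℓ
  have hN : (0 : ℝ) < (N : ℝ) + 1 := by positivity
  rw [mul_right_comm, Nat.cast_add, Nat.cast_one, ← Real.rpow_add hN]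
  norm_num

/-- `Δℓ_N (N+1)^{1/3} → ∞`. -/
theorem tendsto_lineWindow_mul_rpow_atTop :
    Tendsto (fun N : ℕ => Δℓ N * ((N + 1 : ℕ) : ℝ) ^ ((1 : ℝ) / 3)) atTop atTop := by
  simp only [lineWindow_mul_rpow]
  refine Real.tendsto_log_atTop.comp ?_
  exact tendsto_atTop_add_const_right _ _ tendsto_natCast_atTop_atTop

/-- `Δℓ_N → 0`. -/
theorem tendsto_lineWindow_nhds_zero : Tendsto Δℓ atTop (𝓝 0) := by
  -- `Δℓ N ≤ (log 2 + log (N+1)) / (N+1)^{1/3}` and both pieces tend to `0`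
  have hx : Tendsto (fun N : ℕ => (N : ℝ) + 1) atTop atTop :=
    tendsto_atTop_add_const_right _ _ tendsto_natCast_atTop_atTop
  have h13 : (0 : ℝ) < 1 / 3 := by norm_num
  have hpow : Tendsto (fun N : ℕ => ((N : ℝ) + 1) ^ ((1 : ℝ) / 3)) atTop atTop :=
    (tendsto_rpow_atTop h13).comp hx
  have h1 : Tendsto (fun N : ℕ => Real.log ((N : ℝ) + 1) / ((N : ℝ) + 1) ^ ((1 : ℝ) / 3))
      atTop (𝓝 0) :=
    ((isLittleO_log_rpow_atTop h13).comp_tendsto hx).tendsto_div_nhds_zero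
  have h2 : Tendsto (fun N : ℕ => Real.log 2 / ((N : ℝ) + 1) ^ ((1 : ℝ) / 3)) atTop (𝓝 0) :=
    hpow.const_div_atTop _
  have hsum : Tendsto (fun N : ℕ => Real.log 2 / ((N : ℝ) + 1) ^ ((1 : ℝ) / 3) +
      Real.log ((N : ℝ) + 1) / ((N : ℝ) + 1) ^ ((1 : ℝ) / 3)) atTop (𝓝 0) := by
    simpa using h2.add h1
  refine squeeze_zero (fun N => (lineWindow_pos N).le) (fun N => ?_) hsum
  -- the pointwise bound
  have hN : (0 : ℝ) < (N : ℝ) + 1 := by positivity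
  have hp : (0 : ℝ) < ((N : ℝ) + 1) ^ ((1 : ℝ) / 3) := Real.rpow_pos_of_pos hN _
  have hlog : Real.log ((N : ℝ) + 2) ≤ Real.log 2 + Real.log ((N : ℝ) + 1) := by
    rw [← Real.log_mul (by norm_num) hN.ne']
    exact Real.log_le_log (by positivity) (by linarith)
  have hΔ : Δℓ N = Real.log ((N : ℝ) + 2) / ((N : ℝ) + 1) ^ ((1 : ℝ) / 3) := by
    unfold Δℓ
    rw [show (-(1 : ℝ)) / 3 = -((1 : ℝ) / 3) by ring, Real.rpow_neg hN.le, inv_mul_eq_div]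
  rw [hΔ, ← add_div]
  exact div_le_div_of_nonneg_right hlog hp.le

/-- H1 ON THE LINE WINDOW: `DiffuseAt` gives, for every `t > 0`, that the local-Gibbs mean of
`iprF` over `[t − Δℓ_N, t]` tends to `0`. -/
theorem diffuseAt_lineWindow {σ : ℝ} {a₀ θ₀ : T3 → ℝ} {u₀ : T3 → V3} {Φ : Flows σ}
    (h : DiffuseAt σ a₀ θ₀ u₀ Φ) (t : ℝ) (ht : 0 < t) :
    Tendsto (fun N : ℕ => ∫⁻ z, ENNReal.ofReal (iprF σ N ((Φ N).flow (t - Δℓ N) z) (Δℓ N))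
      ∂(localGibbsLaw σ a₀ u₀ θ₀ N (Φ N))) atTop (𝓝 0) :=
  h Δℓ lineWindow_pos tendsto_lineWindow_nhds_zero tendsto_lineWindow_mul_rpow_atTop t ht

/-! ## The collision-rate input -/

/-- **MANY COLLISIONS on the line window** at `(σ, profiles, Φ)` (typed, asserted nowhere): for
every `K` and every `t > 0`, the local-Gibbs probability that the fold restarted at
`y = Φ_{t − Δℓ_N} z` performs fewer than `K(N+1)` steps with collision instant in the second half
`(Δℓ_N/2, Δℓ_N]` of the line window tends to `0`. Physically the number of collisions per particle
per half-window is `≍ σ² log N → ∞`; this is the RATE input of the depolarisation mechanism (the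
final stretches on which one-step non-degeneracy is consumed must contain `K(N+1)` steps for every
`K`), and it does not follow from H1 (three own reflections with pairwise orthogonal normals
already delocalise a row completely). -/
def ManyCollisionsAt (σ : ℝ) (a₀ θ₀ : T3 → ℝ) (u₀ : T3 → V3) (Φ : Flows σ) : Prop :=
  ∀ (K : ℕ) (t : ℝ), 0 < t →
    Tendsto (fun N : ℕ => localGibbsLaw σ a₀ u₀ θ₀ N (Φ N)
      {z | steps σ N ((Φ N).flow (t - Δℓ N) z) (Δℓ N) <
        steps σ N ((Φ N).flow (t - Δℓ N) z) (Δℓ N / 2) + K * (N + 1)}) atTop (𝓝 0)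

end

end ColumnDepolarisation
end Summit.AtomisticToContinuum.HydrodynamicLimit.Theorems.ContactSourceDuhamel.TimeLocal
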